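import Mathlib
import Summits.ValiantsHypothesis.ValiantsHypothesis.Theorems.FifoMatchingNNDivisionHardLongSpreadLaw
import HarnessLib

/-!
# Route FifoMatching — crux `NNDivisionHard` (stmt-ValiantsHypothesis-21181): the arcs of the padded thick queue live in a BAND

Twin of `FifoMatchingNNDivisionHardPadWordLongArcs.lean`.  There: every arc of the FIFO pairing of the padded thick word
`W = U^L v D^L` (`v` balanced, prefix sums in `(-m, m)`, `1 ≤ m ≤ L`) has length `≥ L − m + 1`.  Here the UPPER bound: every
arc has length `≤ 2L + 2m − 1`, because the queue never holds more than `2L + 2m − 1` arcs... more precisely because an arc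
closed at time `t` was opened at or after time `t + 1 − (2L + 2m)` (at most `L` padding openers plus a surplus `< m` of `v`
wait in front of it, and at least every other step of `v` closes an arc up to the deficit `m`).  So the thick-queue measure
lives on matchings ALL of whose arcs have length in the band `[L − m + 1, 2L + 2m − 1]` — at the parameters of
`NNMonotoneExpBound` (`m = u³`, `L = 8u⁴ + 3u³`) the band `[8u⁴ + 2u³ + 1, 16u⁴ + 8u³ − 1]`, of ratio `< 2`, at scale
`Θ(n^{4/5})` for the maximal admissible `u` and down to `Θ((n log n)^{2/3})` for the least.

* ★ `card_openers_lt_le_card_closers_lt_advance` — the ADVANCED queue inequality: at every closer time `t`,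
  `#openers<(t + 1 − (2L + 2m)) ≤ #closers<t`;
* ★★ `closer_lt_opener_add` — `c_k + 1 ≤ o_k + (2L + 2m)` for the `k`-th opener / closer; `fifo_padWord_arcs_le`,
  `cast_fifo_padWord_arcs_band` — every arc of `fifo W` (transported to `Fin (2n)`) has length in `[L − m + 1, 2L + 2m − 1]`;
* ★★ `exists_thick_measure_band` — the thick-queue measure (hypotheses of `NNMonotoneHard.exists_thick_measure`) with the
  BAND support clause; `exists_thick_measure_of_le_band` — the same at the `NNMonotoneExpBound` parameters for EVERY `u ≥ 1`
  and every `n ≥ T(u) = 192u⁵ + 176u⁴ + 29u³ + 24u + 4` satisfying the band estimate, with band `[8u⁴ + 2u³ + 1, 16u⁴ + 8u³ − 1]`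
  and spread `2N (3/4)^{4u}`.

Consumer: `…BandLocal.lean` (cofactors with no variable in the band are not certificates; certificates are SCALE-COVERING).
HONEST FRAMING: word combinatorics + an export lemma for ONE measure; stmt-21181 stays OPEN; nothing here bears on `NNNotVP`
or on VP ≠ VNP (NOT proved).  No definitions, no named facts.
References: Grytczuk–Pawlik–Ruciński 2025 Prop. 1 [GrytczukPawlikRucinski2025]; Hrubeš–Yehudayoff 2021 §6 [HrubesYehudayoff2021].
-/

noncomputable section

-- Sub = Summit single-conjunct layout: the duplicated namespace component is mandated by the tree.
set_option linter.dupNamespace false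
set_option autoImplicit false

namespace Summit.ValiantsHypothesis.ValiantsHypothesis.Theorems.FifoMatching.NNDivisionHard.PadWordArcBand

open Finset Literature.Computability.AlgebraicComplexity
open Summit.ValiantsHypothesis.ValiantsHypothesis.Theorems.FifoMatching.NNMonotoneHard
open Summit.ValiantsHypothesis.ValiantsHypothesis.Theorems.FifoMatching.NNDivisionHard.PadWordLongArcs
open Summit.ValiantsHypothesis.ValiantsHypothesis.Theorems.FifoMatching.NNDivisionHard.ThickMeasureSupport
  (exists_thick_measure_supported)
open scoped NNReal

/-! ### §1 The advanced queue inequality for `U^L v D^L` -/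

section Pad

variable {L N m : ℕ} (v : Fin N → Bool)

/-- ★ **The ADVANCED queue inequality.**  Let `v` be balanced with prefix sums in `(-m, m)` (both sides), `1 ≤ m ≤ L`, and
let `t` be a CLOSER time of `W = U^L v D^L`.  Then `#openers<(t + 1 − (2L + 2m)) ≤ #closers<t`: the arc closed at time `t`
was opened at or after time `t + 1 − (2L + 2m)`.  Proof by the three phases of the rank bookkeeping: in the middle at least
every other letter of `v` up to the deficit `m` is a closer, and at most `L` padding openers plus a surplus `< m` wait in the
queue. [folklore] -/
theorem card_openers_lt_le_card_closers_lt_advance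
    (hbal : 2 * ((univ : Finset (Fin N)).filter fun p => v p = true).card = N)
    (hband : ∀ j, j ≤ N →
      ((univ : Finset (Fin N)).filter fun p => p.val < j ∧ v p = false).card
        < ((univ : Finset (Fin N)).filter fun p => p.val < j ∧ v p = true).card + m ∧
      ((univ : Finset (Fin N)).filter fun p => p.val < j ∧ v p = true).card
        < ((univ : Finset (Fin N)).filter fun p => p.val < j ∧ v p = false).card + m)
    (hmL : m ≤ L) (hm : 1 ≤ m) {t : ℕ} (htM : t < L + N + L)
    (ht : padWord L N v ⟨t, htM⟩ = false) :
    ((openerSet (padWord L N v)).filter fun i => i.val < t + 1 - (2 * L + 2 * m)).card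
      ≤ ((closerSet (padWord L N v)).filter fun i => i.val < t).card := by
  -- the first `L` letters are openers, so `L ≤ t`
  have hLt : L ≤ t := by
    by_contra hlt
    rw [not_le] at hlt
    have h1 := padWord_apply_of_lt (L := L) (N := N) v (i := ⟨t, htM⟩) hlt
    rw [h1] at ht
    exact Bool.noConfusion ht
  have hD := two_mul_card_false v hbal
  have hUD := card_true_add_card_false v
  -- the advanced time in the head: `#openers<s = s`
  rcases le_or_gt (t + 1 - (2 * L + 2 * m)) L with hs | hs
  · rw [(ranks_padWord_head (L := L) (N := N) v (t := t + 1 - (2 * L + 2 * m)) hs).1]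
    rcases lt_or_ge t (L + N) with hmid | htail
    · -- middle phase
      obtain ⟨j, rfl⟩ : ∃ j, t = L + j := ⟨t - L, by omega⟩
      have hj : j < N := by omega
      rw [(ranks_padWord_mid (L := L) (N := N) v (j := j) hj.le).2]
      have hb := (hband j hj.le).2
      have hsum := card_lt_true_add_card_lt_false v hj.le
      omega
    · -- tail phase
      obtain ⟨i, rfl⟩ : ∃ i, t = L + N + i := ⟨t - L - N, by omega⟩
      have hi : i < L := by omega
      rw [(ranks_padWord_tail (L := L) (N := N) v (i := i) hi.le).2]
      omega
  -- the advanced time in the middle: `s = L + j'`, `j' ≤ N`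
  have hs' : t + 1 - (2 * L + 2 * m) ≤ L + N := by omega
  have e : t + 1 - (2 * L + 2 * m) = L + (t + 1 - (2 * L + 2 * m) - L) := by omega
  have hj' : t + 1 - (2 * L + 2 * m) - L ≤ N := by omega
  rw [e, (ranks_padWord_mid (L := L) (N := N) v (j := t + 1 - (2 * L + 2 * m) - L) hj').1]
  have hb' := (hband (t + 1 - (2 * L + 2 * m) - L) hj').2
  have hsum' := card_lt_true_add_card_lt_false v hj'
  rcases lt_or_ge t (L + N) with hmid | htail
  · -- middle phase
    obtain ⟨j, rfl⟩ : ∃ j, t = L + j := ⟨t - L, by omega⟩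
    have hj : j < N := by omega
    rw [(ranks_padWord_mid (L := L) (N := N) v (j := j) hj.le).2]
    have hb := (hband j hj.le).2
    have hsum := card_lt_true_add_card_lt_false v hj.le
    omega
  · -- tail phase
    obtain ⟨i, rfl⟩ : ∃ i, t = L + N + i := ⟨t - L - N, by omega⟩
    have hi : i < L := by omega
    rw [(ranks_padWord_tail (L := L) (N := N) v (i := i) hi.le).2]
    omega

/-- ★★ **Every FIFO arc of the padded thick word is not too long**: `c_k + 1 ≤ o_k + (2L + 2m)` for the `k`-th opener `o_k`
and the `k`-th closer `c_k` of `W = U^L v D^L` (`v` balanced, prefix sums in `(-m, m)`, `1 ≤ m ≤ L`).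
[cite: GrytczukPawlikRucinski2025, Prop. 1] -/
theorem closer_lt_opener_add
    (hbal : 2 * ((univ : Finset (Fin N)).filter fun p => v p = true).card = N)
    (hband : ∀ j, j ≤ N →
      ((univ : Finset (Fin N)).filter fun p => p.val < j ∧ v p = false).card
        < ((univ : Finset (Fin N)).filter fun p => p.val < j ∧ v p = true).card + m ∧
      ((univ : Finset (Fin N)).filter fun p => p.val < j ∧ v p = true).card
        < ((univ : Finset (Fin N)).filter fun p => p.val < j ∧ v p = false).card + m)
    (hmL : m ≤ L) (hm : 1 ≤ m) (k : Fin (openerSet (padWord L N v)).card) :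
    ((closerSet (padWord L N v)).orderEmbOfFin (balanced_padWord v hbal) k : ℕ) + 1
      ≤ ((openerSet (padWord L N v)).orderEmbOfFin rfl k : ℕ) + (2 * L + 2 * m) := by
  -- the `k`-th closer `c` is a closer of closer-rank `k`
  have hWc : padWord L N v ((closerSet (padWord L N v)).orderEmbOfFin (balanced_padWord v hbal) k) = false :=
    apply_closer (balanced_padWord v hbal) k
  have hrk : ((closerSet (padWord L N v)).filter fun i =>
      i < (closerSet (padWord L N v)).orderEmbOfFin (balanced_padWord v hbal) k).card = k :=
    card_filter_lt_orderEmbOfFin (balanced_padWord v hbal) k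
  rw [filter_lt_fin_eq] at hrk
  -- the advanced inequality at time `c`
  have hadv := card_openers_lt_le_card_closers_lt_advance v hbal hband hmL hm
    ((closerSet (padWord L N v)).orderEmbOfFin (balanced_padWord v hbal) k).isLt hWc
  rw [hrk] at hadv
  -- hence `c + 1 - (2L + 2m) ≤ o_k`
  have htM : ((closerSet (padWord L N v)).orderEmbOfFin (balanced_padWord v hbal) k : ℕ) + 1 - (2 * L + 2 * m)
      < L + N + L := by
    have := ((closerSet (padWord L N v)).orderEmbOfFin (balanced_padWord v hbal) k).isLt
    omega
  have hle : (⟨((closerSet (padWord L N v)).orderEmbOfFin (balanced_padWord v hbal) k : ℕ) + 1 - (2 * L + 2 * m), htM⟩ :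
        Fin (L + N + L)) ≤ (openerSet (padWord L N v)).orderEmbOfFin rfl k := by
    rw [le_orderEmbOfFin_iff, filter_lt_fin_eq]
    exact hadv
  rw [Fin.le_def] at hle
  change ((closerSet (padWord L N v)).orderEmbOfFin (balanced_padWord v hbal) k : ℕ) + 1 - (2 * L + 2 * m)
    ≤ ((openerSet (padWord L N v)).orderEmbOfFin rfl k : ℕ) at hle
  omega

/-- ★★ **All arcs of `fifo (U^L v D^L)` have length `≤ 2L + 2m − 1`**: `fifo W h i + 1 ≤ i + (2L + 2m)` for every opener `i`.
[cite: GrytczukPawlikRucinski2025, Prop. 1] -/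
theorem fifo_padWord_arcs_le
    (hbal : 2 * ((univ : Finset (Fin N)).filter fun p => v p = true).card = N)
    (hband : ∀ j, j ≤ N →
      ((univ : Finset (Fin N)).filter fun p => p.val < j ∧ v p = false).card
        < ((univ : Finset (Fin N)).filter fun p => p.val < j ∧ v p = true).card + m ∧
      ((univ : Finset (Fin N)).filter fun p => p.val < j ∧ v p = true).card
        < ((univ : Finset (Fin N)).filter fun p => p.val < j ∧ v p = false).card + m)
    (hmL : m ≤ L) (hm : 1 ≤ m) {i : Fin (L + N + L)} (hi : padWord L N v i = true) :
    (fifo (padWord L N v) (balanced_padWord v hbal) i : ℕ) + 1 ≤ (i : ℕ) + (2 * L + 2 * m) := by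
  obtain ⟨k, rfl⟩ := exists_eq_opener hi
  rw [fifo_opener]
  exact closer_lt_opener_add v hbal hband hmL hm k

/-- ★★ **Transported BAND form** (matchings of `Fin (2n)`, `2n = L + N + L`): every arc of `i ↦ cast (fifo (U^L v D^L) (cast⁻¹ i))`
has length in `[L − m + 1, 2L + 2m − 1]`. [cite: GrytczukPawlikRucinski2025, Prop. 1] -/
theorem cast_fifo_padWord_arcs_band {n : ℕ} (hM : L + N + L = 2 * n)
    (hbal : 2 * ((univ : Finset (Fin N)).filter fun p => v p = true).card = N)
    (hband : ∀ j, j ≤ N →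
      ((univ : Finset (Fin N)).filter fun p => p.val < j ∧ v p = false).card
        < ((univ : Finset (Fin N)).filter fun p => p.val < j ∧ v p = true).card + m ∧
      ((univ : Finset (Fin N)).filter fun p => p.val < j ∧ v p = true).card
        < ((univ : Finset (Fin N)).filter fun p => p.val < j ∧ v p = false).card + m)
    (hmL : m ≤ L) (hm : 1 ≤ m) :
    ∀ i ∈ openers (fun i : Fin (2 * n) =>
        Fin.cast hM (fifo (padWord L N v) (balanced_padWord v hbal) (Fin.cast hM.symm i))),
      (i : ℕ) + (L - m + 1)
          ≤ (Fin.cast hM (fifo (padWord L N v) (balanced_padWord v hbal) (Fin.cast hM.symm i)) : ℕ) ∧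
        (Fin.cast hM (fifo (padWord L N v) (balanced_padWord v hbal) (Fin.cast hM.symm i)) : ℕ) + 1
          ≤ (i : ℕ) + (2 * L + 2 * m) := by
  intro i hi
  refine ⟨cast_fifo_padWord_arcs_long v hM hbal hband hmL hm i hi, ?_⟩
  rw [mem_openers, Fin.lt_def, Fin.val_cast] at hi
  have hio : padWord L N v (Fin.cast hM.symm i) = true :=
    (lt_fifo_iff (isBallot_padWord v hbal (fun j hj => (hband j hj).1) hmL) (Fin.cast hM.symm i)).1
      (by rw [Fin.lt_def, Fin.val_cast]; exact hi)
  have h := fifo_padWord_arcs_le v hbal hband hmL hm hio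
  rw [Fin.val_cast] at h
  rw [Fin.val_cast]
  exact h

end Pad

/-! ### §2 The thick-queue measure lives on the band -/

/-- ★★ **The thick-queue measure, BAND form.**  Under the hypotheses of `NNMonotoneHard.exists_thick_measure` there is a
probability weighting of the nest-free perfect matchings of `[2n]` respecting every balanced split with mass `≤ 2N (3/4)^r` and
**supported on matchings all of whose arcs have length in `[L − m + 1, 2L + 2m − 1]`**. [cite: HrubesYehudayoff2021, §6 Problem 2] -/
theorem exists_thick_measure_band {n L N m K J r : ℕ} (hM : L + N + L = 2 * n)
    (hmL : m ≤ L) (hm : 1 ≤ m) (hK : 2 * L + 4 * m + 2 ≤ K) (hJ : J * K + 1 ≤ N)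
    (hr1 : 4 * r ≤ J) (hr3 : 2 * m * r + 3 * m ≤ L)
    (hreg : 3 * (2 * K * r + (2 * n - J * K)) ≤ 2 * n)
    (hNpos : 0 < N)
    (hband : 2 * (N : ℝ) * Real.exp (-((m : ℝ) ^ 2 / (2 * N))) * 2 ^ N ≤ 2 ^ N / (2 * N)) :
    ∃ μ : (Fin (2 * n) → Fin (2 * n)) → ℝ≥0,
      (∑ Mt ∈ nestFreeMatchings (2 * n), μ Mt = 1) ∧
      (∀ S : Finset (Fin (2 * n)), 2 * n < 3 * S.card → 3 * S.card ≤ 4 * n →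
        (∑ Mt ∈ (nestFreeMatchings (2 * n)).filter (fun Mt => ∀ i, i ∈ S ↔ Mt i ∈ S), μ Mt)
          ≤ (2 * N : ℝ≥0) * ((3 : ℝ≥0) / 4) ^ r) ∧
      (∀ Mt ∈ nestFreeMatchings (2 * n), μ Mt ≠ 0 →
        ∀ i ∈ openers Mt, (i : ℕ) + (L - m + 1) ≤ (Mt i : ℕ) ∧ (Mt i : ℕ) + 1 ≤ (i : ℕ) + (2 * L + 2 * m)) := by
  obtain ⟨μ, h1, h2, h3⟩ := exists_thick_measure_supported hM hmL hm hK hJ hr1 hr3 hreg hNpos hband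
  refine ⟨μ, h1, h2, fun Mt _ hMt => ?_⟩
  obtain ⟨v, hb, hbd, rfl⟩ := h3 Mt hMt
  exact cast_fifo_padWord_arcs_band v hM hb hbd hmL hm

/-- ★★ **The banded thick-queue measure at EVERY admissible parameter** (`u ≥ 1`, `m = u³`, `L = 8mu + 3m`, `K = 2L + 4m + 2`,
`N = 2n − 2L`, every `n ≥ 12Ku + 3L + 2K = 192u⁵ + 176u⁴ + 29u³ + 24u + 4` with the band estimate): mass `≤ 2N (3/4)^{4u}` on
every balanced split, support on matchings with all arcs of length in `[8u⁴ + 2u³ + 1, 16u⁴ + 8u³ − 1]`. [folklore] -/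
theorem exists_thick_measure_of_le_band {u n m L K N : ℕ} (hu : 1 ≤ u) (hm : m = u ^ 3)
    (hL : L = 8 * m * u + 3 * m) (hK : K = 2 * L + 4 * m + 2) (hN : N = 2 * n - 2 * L)
    (hT : 12 * K * u + 3 * L + 2 * K ≤ n)
    (hband : 2 * (N : ℝ) * Real.exp (-((m : ℝ) ^ 2 / (2 * N))) * 2 ^ N ≤ 2 ^ N / (2 * N)) :
    ∃ μ : (Fin (2 * n) → Fin (2 * n)) → ℝ≥0,
      (∑ Mt ∈ nestFreeMatchings (2 * n), μ Mt = 1) ∧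
      (∀ S : Finset (Fin (2 * n)), 2 * n < 3 * S.card → 3 * S.card ≤ 4 * n →
        (∑ Mt ∈ (nestFreeMatchings (2 * n)).filter (fun Mt => ∀ i, i ∈ S ↔ Mt i ∈ S), μ Mt)
          ≤ (2 * N : ℝ≥0) * ((3 : ℝ≥0) / 4) ^ (4 * u)) ∧
      (∀ Mt ∈ nestFreeMatchings (2 * n), μ Mt ≠ 0 →
        ∀ i ∈ openers Mt, (i : ℕ) + (8 * u ^ 4 + 2 * u ^ 3 + 1) ≤ (Mt i : ℕ) ∧
          (Mt i : ℕ) + 1 ≤ (i : ℕ) + (16 * u ^ 4 + 8 * u ^ 3)) := by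
  set J : ℕ := (N - 1) / K with hJ
  have hKpos : 0 < K := by rw [hK]; omega
  have hm1 : 1 ≤ m := by rw [hm]; exact Nat.one_le_pow _ _ hu
  -- linearise the products for `omega`
  have eT : 12 * K * u = 12 * (K * u) := by ring
  have eL : 8 * m * u = 8 * (m * u) := by ring
  have er : 2 * K * (4 * u) = 8 * (K * u) := by ring
  have e16 : 4 * (4 * u) * K = 16 * (K * u) := by ring
  have emr : 2 * m * (4 * u) + 3 * m = 8 * (m * u) + 3 * m := by ring
  have e4 : u ^ 4 = m * u := by rw [hm]; ring
  rw [eT] at hT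
  have hLn : L ≤ n := by omega
  have hM : L + N + L = 2 * n := by rw [hN]; omega
  have hmL : m ≤ L := by rw [hL, eL]; omega
  have hKe : 2 * L + 4 * m + 2 ≤ K := by rw [hK]
  have hNpos : 0 < N := by rw [hN]; omega
  -- `J K ≤ N - 1 < J K + K`
  have hdiv : K * J + (N - 1) % K = N - 1 := by rw [hJ]; exact Nat.div_add_mod (N - 1) K
  have hmod : (N - 1) % K < K := Nat.mod_lt _ hKpos
  have eKJ : K * J = J * K := Nat.mul_comm _ _
  have hJK : J * K + 1 ≤ N := by omega
  have hJK' : N ≤ J * K + K := by omega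
  have hr1 : 4 * (4 * u) ≤ J := by
    rw [hJ, Nat.le_div_iff_mul_le hKpos, e16]
    omega
  have hr3 : 2 * m * (4 * u) + 3 * m ≤ L := by rw [emr, hL, eL]
  have hreg : 3 * (2 * K * (4 * u) + (2 * n - J * K)) ≤ 2 * n := by
    rw [er]
    omega
  obtain ⟨μ, h1, h2, h3⟩ := exists_thick_measure_band hM hmL hm1 hKe hJK hr1 hr3 hreg hNpos hband
  refine ⟨μ, h1, h2, fun Mt hMt hμ i hi => ?_⟩
  obtain ⟨hlo, hhi⟩ := h3 Mt hMt hμ i hi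
  have elo : L - m + 1 = 8 * u ^ 4 + 2 * u ^ 3 + 1 := by rw [hL, eL, e4, hm]; omega
  have ehi : 2 * L + 2 * m = 16 * u ^ 4 + 8 * u ^ 3 := by rw [hL, eL, e4, hm]; ring
  rw [elo] at hlo
  rw [ehi] at hhi
  exact ⟨hlo, hhi⟩

end Summit.ValiantsHypothesis.ValiantsHypothesis.Theorems.FifoMatching.NNDivisionHard.PadWordArcBand

end
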